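import Literature.MathematicalPhysics.QuantumFieldTheory.Balaban1983to89.B11LeafKnitTwoTier

/-!
# `Balaban1983to89.B11Thm1TwoTierOneSided` — the induction on `k` of [Balaban1985Variational] Theorem 1 (printed tower `B11Thm1.Tower` and repaired
# two-tier tower `B11Thm1TwoTier.TowerT`) with the dictionary's RESTRICTION LAW asked ONE-SIDEDLY (for `e ≤ e′` only) — the local-minimum half of
# `B11.VarProblemX.Laws` (iii) (cell DIVERGENCE D-B11-2) is NOT an input of Theorem 1's architecture once (7) is monotone in `ε₁`

T. Bałaban, *The variational problem and background fields in renormalization group method for lattice gauge theories*, Commun. Math. Phys. **102**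
(1985) 277–309 [Balaban1985Variational], doi:10.1007/bf01229381 (cell paper B11; PDF held `paper:balaban1985-cmp102-variational-background`, journal page =
pdf + 276).  Cell `pub-ymgap` (HUMAN RULING D-0062), Track A node N07, seat `pub-ymgap-dag-n07-e` (finding F-n07e-1); a NEW importing module over
`B11LeafKnitTwoTier` (p409448) → `B11Thm1TwoTier` (b2b-balaban-b11-g4) → `B11Thm1` (pv12) → `B11` (r2); nothing there is modified.  THEOREMS ONLY (0 `def`, 0 `sorry`).

WHAT IS AT STAKE.  r2's dictionary `B11.VarProblemX.Laws` clause (iii) — «a configuration on a minimal orbit in 𝔘_k(e′) ∩ 𝔅_k(V) which lies in 𝔘_k(e) is on a minimal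
orbit in 𝔘_k(e) ∩ 𝔅_k(V)» for ALL `e, e′` — is, for `e′ < e`, a LOCAL-minimum reading (D-B11-2: p. 299 [pdf 23] *«A second order differential at A′ = 0 … is
positive definite. Hence A′ = 0 is a minimum»*, a sentence INSIDE the proof of Proposition 7), and at lattice instances it is the residual hypothesis `hloc` of every
N07 closer.  Yet the architecture consumes (iii) exactly once (`B11Thm1.thm1_clauses_of_background` :310, `B11.thm1_of_prop7_prop8_sectF` :462): p. 304 [pdf 28]
*«We have constructed the minimal configuration U_k in the space (2) with ε₀ = O(1)B₃ε₁ … Especially it implies that U_k is in the space (8).»* — at `e = B₃ε₁ ≤ e′ =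
O(1)C₁B₃ε₁`, the ELEMENTARY direction.  The typed `Prop7From14` only asks `0 < O₁`; if `O₁C₁ < 1`, Proposition 7 (ii) is applied to the same `V` and background at
`ε₁′ = ε₁∕m ≥ ε₁`, `m = min{1, O₁C₁}` (legal once (7) and (14) are MONOTONE in `ε₁`), whose orbit radius `O₁C₁B₃ε₁′ ≥ B₃ε₁` makes the elementary direction
suffice; price `a₁ ↦ min{m·a′₁, a₁(F), m·a₅∕(O₁C₁B₃), a₀∕B₃}` (print: `m = 1`).

WHAT IS PROVED (displayed dictionary per member `(n, i)`: (i) `mono`; (ii) `minlaw` minimal ⇒ critical ∧ in the space; (iii′) `restr` = (iii) for `e ≤ e′` ONLY;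
(iv) `uniq`; plus `mono7` = (7) monotone in `ε₁` and `monoNear` = (14)'s second radius monotone — both immediate at every lattice instance (`PlaqSmall`; clause 5 of
`TowerT.ClassLaws`)): §1 `thm1_clauses_of_background_oneSided` (pv12's level-free step `thm1_clauses_of_background`); §2 `thm1At_allLevels_oneSided` (the printed
tower's induction `B11Thm1.thm1At_allLevels`, + (v) `nearOfInB`), `oneSided_of_lawsA` (the old binder `∀ n i, (T.fam n i).LawsA` yields (i), (ii), (iii′), (iv), (v));
§3 `thm1TAt_allLevels_oneSided`, `background_of_thm1TAt_oneSided` (the repaired two-tier induction of `B11Thm1TwoTier`, same constants `B₃″ = κ₀B₃`;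
then `B11Thm1TwoTier.thm1At_of_thm1TAt`); §4 `thm1TAt_towerT_of_parts_oneSided`, `prop7Printed_towerT_of_parts_oneSided` (`B11LeafKnitTwoTier`'s knit from
Props 2, 5, 6 with the bridges `famD ∕ β ∕ bg ∕ hbg14` and `ExistenceLeavesCap`).
HONEST FRAMING: kernel bookkeeping of a published proof architecture; removes one non-printed hypothesis from the induction's inputs and adds two trivially-instantiated
ones; NOTHING of Sects. B–G asserted; not a claim about the Yang–Mills mass gap; one finite lattice programme — nothing continuum ∕ ℝ⁴ ∕ OS ∕ Clay.
-/

namespace Literature.MathematicalPhysics.QuantumFieldTheory.Balaban1983to89.B11Thm1TwoTierOneSided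

open Literature.MathematicalPhysics.QuantumFieldTheory.Balaban1983to89
open Literature.MathematicalPhysics.QuantumFieldTheory.Balaban1983to89.B11
open Literature.MathematicalPhysics.QuantumFieldTheory.Balaban1983to89.B11Thm1
open Literature.MathematicalPhysics.QuantumFieldTheory.Balaban1983to89.B11Thm1TwoTier
open Literature.MathematicalPhysics.QuantumFieldTheory.Balaban1983to89.B11Prop7Assembly (Bridge ExistenceLeavesCap)

/-! ## §1 The level-free step from a background, under the one-sided dictionary -/

section Printed

variable (T : Tower)
  (mono : ∀ (n : ℕ) (i : T.I n) (e e' : ℝ) (U : (T.fam n i).Cfg), e ≤ e' → (T.fam n i).InU e U → (T.fam n i).InU e' U)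
  (minlaw : ∀ (n : ℕ) (i : T.I n) (e : ℝ) (V : (T.fam n i).Bdry) (U : (T.fam n i).Cfg),
    (T.fam n i).OnMinimalOrbit e V U → (T.fam n i).IsCritical V U ∧ (T.fam n i).InU e U ∧ (T.fam n i).InB V U)
  (restr : ∀ (n : ℕ) (i : T.I n) (e e' : ℝ) (V : (T.fam n i).Bdry) (U : (T.fam n i).Cfg), e ≤ e' →
    (T.fam n i).OnMinimalOrbit e' V U → (T.fam n i).InU e U → (T.fam n i).OnMinimalOrbit e V U)
  (uniq : ∀ (n : ℕ) (i : T.I n) (ε₀ : ℝ) (V : (T.fam n i).Bdry) (U : (T.fam n i).Cfg), (T.fam n i).InU ε₀ U → (T.fam n i).InB V U →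
    (T.fam n i).IsCritical V U →
      (∀ U' : (T.fam n i).Cfg, (T.fam n i).InU ε₀ U' → (T.fam n i).InB V U' → (T.fam n i).IsCritical V U' → (T.fam n i).SameOrbit U' U) →
        (T.fam n i).UniqueCriticalOrbit ε₀ V U)
  (mono7 : ∀ (n : ℕ) (i : T.I n) (ε ε' : ℝ) (V : (T.fam n i).Bdry), ε ≤ ε' → (T.fam n i).Reg7 ε V → (T.fam n i).Reg7 ε' V)
  (monoNear : ∀ (n : ℕ) (i : T.I n) (b b' : ℝ) (V : (T.fam n i).Bdry) (U : (T.fam n i).Cfg), b ≤ b' →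
    (T.fam n i).Near b V U → (T.fam n i).Near b' V U)
include mono minlaw restr uniq mono7 monoNear in
/-- **Theorem 1 at one level ⇐ a background with (14), ONE-SIDED DICTIONARY** — pv12's `thm1_clauses_of_background` with law (iii) used for `e ≤ e′` only: for `V` with (7),
`0 < ε₁ ≤ a₁ := min{m·a′₁, a₁(F), m·a₅∕(O₁C₁B₃), a₀∕B₃}` (`m = min{1, O₁C₁}`) and a background `U₀` with (14), Proposition 7 (ii) is invoked at `ε₁∕m` (same `V`, same `U₀`, by
the monotonicity of (7) and of (14)), Proposition 8 at `ε₀ = O₁C₁B₃ε₁∕m ≤ a₅`, and the elementary restriction places the minimal orbit in (8); uniqueness and regularity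
as in pv12.  Output constants `(a₀, B₃, B₄, M(ε₁) = R₁M₁(a₁∕ε₁))`. [cite: Balaban1985Variational, p.304 («Now we define a₁ … Especially it implies that U_k is in the space (8)»); Thm 1 p.279] -/
theorem thm1_clauses_of_background_oneSided (B₃ C₁ a₀ a₁' O₁ a₅ aF B₄ RM a₁ : ℝ) (hB₃ : 0 < B₃) (hC₁ : 0 < C₁)
    (hK : 0 < O₁ * C₁ * B₃) (hRM : 0 < RM) {m : ℝ} (hm : 0 < m) (hm1 : m ≤ 1) (hmO : m ≤ O₁ * C₁)
    (h1 : a₁ ≤ m * a₁') (h2 : a₁ ≤ aF) (h3 : a₁ ≤ m * a₅ / (O₁ * C₁ * B₃))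
    (H7 : ∀ (n : ℕ) (i : T.I n) (ε₀ ε₁ : ℝ), 0 < ε₁ → ∀ V : (T.fam n i).Bdry, (T.fam n i).Reg7 ε₁ V →
      ∀ U₀ : (T.fam n i).Cfg, (T.fam n i).Sat14 C₁ B₃ ε₁ V U₀ →
        (ε₀ ≤ a₀ → B₃ * ε₁ ≤ ε₀ → (T.fam n i).toVarProblemX.AtMostOneCriticalOrbit ε₀ V) ∧
        (ε₁ ≤ a₁' → ∃ U : (T.fam n i).Cfg, (T.fam n i).OnMinimalOrbit (O₁ * C₁ * B₃ * ε₁) V U))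
    (H8 : ∀ i : (Σ n, T.I n), ∀ ε₀ ε₁ : ℝ, 0 < ε₁ → ∀ V : (T.famAllX i).Bdry, ∀ U : (T.famAllX i).Cfg,
      (T.famAllX i).Reg7 ε₁ V → (T.famAllX i).InU ε₀ U → (T.famAllX i).InB V U → (T.famAllX i).IsCritical V U →
        ε₀ ≤ a₅ → (T.famAllX i).InU (B₃ * ε₁) U)
    (HF : ∀ i : (Σ n, T.I n), ∀ ε₁ : ℝ, ∀ V : (T.famAllX i).Bdry, ∀ U : (T.famAllX i).Cfg, 0 < ε₁ → ε₁ ≤ aF →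
      (T.famAllX i).Reg7 ε₁ V → (T.famAllX i).InU (B₃ * ε₁) U → (T.famAllX i).InB V U →
        (T.famAllX i).IsCritical V U →
          ∀ c : (T.famAllX i).Cube, (T.famAllX i).sizeM c ≤ RM * (aF / ε₁) →
            Regularity (T.famAllX i).toVarProblem B₃ B₄ ε₁ U c)
    (n : ℕ) (i : T.I n) (ε₁ : ℝ) (hε₁ : 0 < ε₁) (hε₁a : ε₁ ≤ a₁) (V : (T.fam n i).Bdry)
    (hV : (T.fam n i).Reg7 ε₁ V) (U₀ : (T.fam n i).Cfg) (h14 : (T.fam n i).Sat14 C₁ B₃ ε₁ V U₀) :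
    Exists8 (T.fam n i).toVarProblem B₃ ε₁ V ∧ Unique6 (T.fam n i).toVarProblem a₀ B₃ ε₁ V ∧
      Reg910 (T.fam n i).toVarProblem B₃ B₄ ε₁ (RM * (a₁ / ε₁)) V := by
  have hOC : 0 < O₁ * C₁ := hm.trans_le hmO
  have hrad : 1 ≤ O₁ * C₁ / m := (one_le_div hm).2 hmO
  -- the rescaled parameter `ε₁' = ε₁/m`: (7) and (14) pass to it by monotonicity
  have hε₁' : 0 < ε₁ / m := div_pos hε₁ hm
  have hε₁le : ε₁ ≤ ε₁ / m := by
    rw [le_div_iff₀ hm]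
    exact mul_le_of_le_one_right hε₁.le hm1
  have hε₁'a : ε₁ / m ≤ a₁' := by
    rw [div_le_iff₀ hm]
    linarith [mul_comm m a₁']
  have hV' : (T.fam n i).Reg7 (ε₁ / m) V := mono7 n i _ _ V hε₁le hV
  have h14' : (T.fam n i).Sat14 C₁ B₃ (ε₁ / m) V U₀ :=
    ⟨mono n i _ _ U₀ (mul_le_mul_of_nonneg_left hε₁le (mul_pos hC₁ hB₃).le) h14.1,
      monoNear n i _ _ V U₀ (mul_le_mul_of_nonneg_left hε₁le hC₁.le) h14.2⟩
  -- existence (p. 304): Prop 7 (ii) at `ε₁/m`, Prop 8 at the orbit radius, one-sided restriction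
  have hex : Exists8 (T.fam n i).toVarProblem B₃ ε₁ V := by
    obtain ⟨U, hU⟩ := (H7 n i a₀ (ε₁ / m) hε₁' V hV' U₀ h14').2 hε₁'a
    obtain ⟨hc, hIn, hB⟩ := minlaw n i _ V U hU
    have hrad' : B₃ * ε₁ ≤ O₁ * C₁ * B₃ * (ε₁ / m) := by
      have e1 : O₁ * C₁ * B₃ * (ε₁ / m) = (O₁ * C₁ / m) * (B₃ * ε₁) := by field_simp
      rw [e1]
      exact le_mul_of_one_le_left (by positivity) hrad
    have hε₀a₅ : O₁ * C₁ * B₃ * (ε₁ / m) ≤ a₅ := by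
      have hKa : a₁ * (O₁ * C₁ * B₃) ≤ m * a₅ := (le_div_iff₀ hK).1 h3
      have hmon : O₁ * C₁ * B₃ * ε₁ ≤ O₁ * C₁ * B₃ * a₁ := mul_le_mul_of_nonneg_left hε₁a hK.le
      rw [show O₁ * C₁ * B₃ * (ε₁ / m) = (O₁ * C₁ * B₃ * ε₁) / m by ring, div_le_iff₀ hm]
      linarith [mul_comm a₁ (O₁ * C₁ * B₃), mul_comm m a₅]
    have h8U := H8 ⟨n, i⟩ _ ε₁ hε₁ V U hV hIn hB hc hε₀a₅
    exact ⟨U, h8U, hB, restr n i _ _ V U hrad' hU h8U⟩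
  refine ⟨hex, ?_, ?_⟩
  · -- uniqueness (Prop 7 (i)) transported by law (iv)
    intro ε₀ hlo hhi U hU
    obtain ⟨hc, hIn, hB⟩ := minlaw n i _ V U hU
    have hIn0 : (T.fam n i).InU ε₀ U := mono n i _ _ U hlo hIn
    have hAM := (H7 n i ε₀ ε₁ hε₁ V hV U₀ h14).1 hhi hlo
    exact uniq n i ε₀ V U hIn0 hB hc (fun U' h1' h2' h3' => hAM U' U h1' h2' h3' hIn0 hB hc)
  · -- regularity (Sect. F) for cubes with `M ≤ R₁M₁(a₁/ε₁) ≤ R₁M₁(a₁(F)/ε₁)`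
    intro U hU c hc
    obtain ⟨hcrit, hIn, hB⟩ := minlaw n i _ V U hU
    have hcF : (T.fam n i).sizeM c ≤ RM * (aF / ε₁) := by
      refine le_trans hc ?_
      have : a₁ / ε₁ ≤ aF / ε₁ := div_le_div_of_nonneg_right h2 hε₁.le
      exact mul_le_mul_of_nonneg_left this hRM.le
    exact HF ⟨n, i⟩ ε₁ V U hε₁ (le_trans hε₁a h2) hV hIn hB hcrit c hcF

/-! ## §2 The printed tower's induction under the one-sided dictionary -/
include mono minlaw restr uniq mono7 monoNear in
/-- **Theorem 1 by induction on `k` on the printed tower, ONE-SIDED DICTIONARY** — `B11Thm1.thm1At_allLevels` with laws (i), (ii), (iii′ for `e ≤ e′`), (iv), (v) and the two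
monotonicities: ONE block of constants `(a₀, a₁, B₃, B₄, M(·))` with `B11Thm1.Thm1At` at every level. [cite: Balaban1985Variational, Thm 1 p.279; Sect. A (11)–(14) pp.279–280; p.304] -/
theorem thm1At_allLevels_oneSided (B₃ : ℝ) (hB₃ : 0 < B₃) (hL : 1 ≤ T.L)
    (nearOfInB : ∀ (n : ℕ) (i : T.I n) (b : ℝ) (V : (T.fam n i).Bdry) (U : (T.fam n i).Cfg), 0 < b → (T.fam n i).InB V U → (T.fam n i).Near b V U)
    (hA11 : StepA11 T) (hA13 : StepA13 T B₃) (hK1 : BaseK1 T B₃)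
    (h7 : Prop7From14 T B₃ (T.L ^ 3)) (h8 : Prop8Printed B₃ T.famAllX) (hF : SectFPrinted B₃ T.famAllX) :
    ∃ C : B11Thm1.Consts, C.B₃ = B₃ ∧ ∀ (n : ℕ) (i : T.I n), Thm1At C (T.fam n i).toVarProblem := by
  obtain ⟨a₀, a₁', O₁, ha₀, ha₁', hO₁, H7⟩ := h7
  obtain ⟨a₅, ha₅, H8⟩ := h8
  obtain ⟨aF, B₄, RM, haF, hB₄, hRM, HF⟩ := hF
  have hLpos : 0 < T.L := lt_of_lt_of_le one_pos hL
  have hK : 0 < O₁ * T.L ^ 3 * B₃ := by positivity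
  -- the rescaling factor and the final `a₁`
  set m : ℝ := min 1 (O₁ * T.L ^ 3) with hmdef
  have hOC : 0 < O₁ * T.L ^ 3 := by positivity
  have hm : 0 < m := lt_min one_pos hOC
  have hm1 : m ≤ 1 := min_le_left _ _
  have hmO : m ≤ O₁ * T.L ^ 3 := min_le_right _ _
  set a₁ : ℝ := min (min (m * a₁') aF) (min (m * a₅ / (O₁ * T.L ^ 3 * B₃)) (a₀ / B₃)) with ha₁def
  have ha₁pos : 0 < a₁ := by
    simp only [ha₁def, lt_min_iff]
    exact ⟨⟨mul_pos hm ha₁', haF⟩, div_pos (mul_pos hm ha₅) hK, div_pos ha₀ hB₃⟩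
  have h1 : a₁ ≤ m * a₁' := le_trans (min_le_left _ _) (min_le_left _ _)
  have h2 : a₁ ≤ aF := le_trans (min_le_left _ _) (min_le_right _ _)
  have h3 : a₁ ≤ m * a₅ / (O₁ * T.L ^ 3 * B₃) := le_trans (min_le_right _ _) (min_le_left _ _)
  have h4 : a₁ ≤ a₀ / B₃ := le_trans (min_le_right _ _) (min_le_right _ _)
  have hB₃a₁ : B₃ * a₁ ≤ a₀ := by
    have := (le_div_iff₀ hB₃).1 h4
    linarith [mul_comm B₃ a₁]
  have step := thm1_clauses_of_background_oneSided T mono minlaw restr uniq mono7 monoNear B₃ (T.L ^ 3) a₀ a₁' O₁ a₅ aF B₄ RM a₁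
    hB₃ (by positivity) hK hRM hm hm1 hmO h1 h2 h3 H7 H8 HF
  refine ⟨⟨a₀, a₁, B₃, B₄, fun e => RM * (a₁ / e), ha₀, ha₁pos, hB₃, hB₄, hB₃a₁, fun e he => by positivity⟩, rfl, ?_⟩
  intro n
  induction n with
  | zero =>
      intro i ε₁ hε₁ hε₁a V hV
      exact step 0 i ε₁ hε₁ hε₁a V hV (T.base i V) (hK1 i ε₁ V hε₁ hV)
  | succ n ih =>
      intro i ε₁ hε₁ hε₁a V hV
      have hV₀ : (T.fam n (T.drop n i)).Reg7 ε₁ (T.V0 n i V) := hA11 n i ε₁ V hV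
      obtain ⟨U', hU'in, hU'B, -⟩ := (ih (T.drop n i) ε₁ hε₁ hε₁a (T.V0 n i V) hV₀).1
      obtain ⟨h13U, h13B⟩ := hA13 n i ε₁ V U' hV hU'in hU'B
      have h14 : (T.fam (n + 1) i).Sat14 (T.L ^ 3) B₃ ε₁ V (T.lift n i U') :=
        ⟨h13U, nearOfInB (n + 1) i _ V _ (by positivity) h13B⟩
      exact step (n + 1) i ε₁ hε₁ hε₁a V hV (T.lift n i U') h14

/-- **The old binder implies the new dictionary**: `∀ n i, (T.fam n i).LawsA` yields (i), (ii), (iii′ for `e ≤ e′`), (iv) and (v) — so, given the two monotonicities,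
every caller of pv12's theorems can call the one-sided ones. [cite: Balaban1985Variational, (2)–(6) p.278 and pp.299–305 (the dictionary of Props 7–8 ∕ Sect. F; bookkeeping)] -/
theorem oneSided_of_lawsA (laws : ∀ n i, (T.fam n i).LawsA) :
    (∀ (n : ℕ) (i : T.I n) (e e' : ℝ) (U : (T.fam n i).Cfg), e ≤ e' → (T.fam n i).InU e U → (T.fam n i).InU e' U) ∧
    (∀ (n : ℕ) (i : T.I n) (e : ℝ) (V : (T.fam n i).Bdry) (U : (T.fam n i).Cfg),
      (T.fam n i).OnMinimalOrbit e V U → (T.fam n i).IsCritical V U ∧ (T.fam n i).InU e U ∧ (T.fam n i).InB V U) ∧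
    (∀ (n : ℕ) (i : T.I n) (e e' : ℝ) (V : (T.fam n i).Bdry) (U : (T.fam n i).Cfg), e ≤ e' →
      (T.fam n i).OnMinimalOrbit e' V U → (T.fam n i).InU e U → (T.fam n i).OnMinimalOrbit e V U) ∧
    (∀ (n : ℕ) (i : T.I n) (ε₀ : ℝ) (V : (T.fam n i).Bdry) (U : (T.fam n i).Cfg), (T.fam n i).InU ε₀ U → (T.fam n i).InB V U → (T.fam n i).IsCritical V U →
      (∀ U' : (T.fam n i).Cfg, (T.fam n i).InU ε₀ U' → (T.fam n i).InB V U' → (T.fam n i).IsCritical V U' → (T.fam n i).SameOrbit U' U) →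
        (T.fam n i).UniqueCriticalOrbit ε₀ V U) ∧
    (∀ (n : ℕ) (i : T.I n) (b : ℝ) (V : (T.fam n i).Bdry) (U : (T.fam n i).Cfg), 0 < b → (T.fam n i).InB V U → (T.fam n i).Near b V U) :=
  ⟨fun n i => (laws n i).1.1, fun n i => (laws n i).1.2.1, fun n i e e' V U _ h hIn => (laws n i).1.2.2.1 e e' V U h hIn, fun n i => (laws n i).1.2.2.2,
    fun n i => (laws n i).2⟩

end Printed

/-! ## §3 The repaired two-tier induction under the one-sided dictionary -/

section TwoTier

variable (T : TowerT)
  (mono : ∀ (n : ℕ) (i : T.I n) (e e' : ℝ) (U : (T.fam n i).Cfg), e ≤ e' → (T.fam n i).InU e U → (T.fam n i).InU e' U)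
  (minlaw : ∀ (n : ℕ) (i : T.I n) (e : ℝ) (V : (T.fam n i).Bdry) (U : (T.fam n i).Cfg),
    (T.fam n i).OnMinimalOrbit e V U → (T.fam n i).IsCritical V U ∧ (T.fam n i).InU e U ∧ (T.fam n i).InB V U)
  (restr : ∀ (n : ℕ) (i : T.I n) (e e' : ℝ) (V : (T.fam n i).Bdry) (U : (T.fam n i).Cfg), e ≤ e' →
    (T.fam n i).OnMinimalOrbit e' V U → (T.fam n i).InU e U → (T.fam n i).OnMinimalOrbit e V U)
  (uniq : ∀ (n : ℕ) (i : T.I n) (ε₀ : ℝ) (V : (T.fam n i).Bdry) (U : (T.fam n i).Cfg), (T.fam n i).InU ε₀ U → (T.fam n i).InB V U →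
    (T.fam n i).IsCritical V U →
      (∀ U' : (T.fam n i).Cfg, (T.fam n i).InU ε₀ U' → (T.fam n i).InB V U' → (T.fam n i).IsCritical V U' → (T.fam n i).SameOrbit U' U) →
        (T.fam n i).UniqueCriticalOrbit ε₀ V U)
  (mono7 : ∀ (n : ℕ) (i : T.I n) (ε ε' : ℝ) (V : (T.fam n i).Bdry), ε ≤ ε' → (T.fam n i).Reg7 ε V → (T.fam n i).Reg7 ε' V)
include mono minlaw restr uniq mono7 in
/-- **Theorem 1″ at all levels of the repaired tower, ONE block of constants, `B₃″ = B₃κ₀`, ONE-SIDED DICTIONARY** — `B11Thm1TwoTier.thm1TAt_allLevels` with the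
dictionary (i), (ii), (iii′), (iv) + (7) monotone (`Near`-monotonicity is clause 5 of `ClassLaws`); the Sects. B–F black box is §1 at the parameter `κ₀ε₁`.
[cite: Balaban1985Variational, Thm 1 p.279; Sect. A pp.279–280; p.304] -/
theorem thm1TAt_allLevels_oneSided (B₃ C₁ : ℝ) (hB₃ : 0 < B₃) (hL : 1 ≤ T.L) (hC₁L : T.L ^ 3 ≤ C₁)
    (hC₁' : T.C₁' ≤ C₁) (cl : T.ClassLaws)
    (hA11 : StepA11T T) (hA13 : StepA13T T) (hK1 : BaseK1T T B₃ C₁)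
    (h7 : Prop7From14 T.toTower B₃ C₁) (h8 : Prop8Printed B₃ T.famAllX) (hF : SectFPrinted B₃ T.famAllX) :
    ∃ C : B11Thm1.Consts, C.B₃ = B₃ * T.κ₀ ∧ ∀ (n : ℕ) (i : T.I n), Thm1TAt T C n i := by
  obtain ⟨hκ₀, hC₁'0, -, hRegT7, hNear⟩ := cl
  obtain ⟨a₀, a₁', O₁, ha₀, ha₁', hO₁, H7⟩ := h7
  obtain ⟨a₅, ha₅, H8⟩ := h8
  obtain ⟨aF, B₄, RM, haF, hB₄, hRM, HF⟩ := hF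
  have hLpos : 0 < T.L := lt_of_lt_of_le one_pos hL
  have hL3 : 1 ≤ T.L ^ 3 := one_le_pow₀ hL
  have hC₁pos : 0 < C₁ := lt_of_lt_of_le (lt_of_lt_of_le one_pos hL3) hC₁L
  have hκ₀pos : 0 < T.κ₀ := lt_of_lt_of_le one_pos hκ₀
  have hK : 0 < O₁ * C₁ * B₃ := by positivity
  -- the rescaling factor, pv12's final `b₁` (p. 304) at the fed parameter, then divided by `κ₀`
  set m : ℝ := min 1 (O₁ * C₁) with hmdef
  have hOC : 0 < O₁ * C₁ := by positivity
  have hm : 0 < m := lt_min one_pos hOC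
  have hm1 : m ≤ 1 := min_le_left _ _
  have hmO : m ≤ O₁ * C₁ := min_le_right _ _
  set b₁ : ℝ := min (min (m * a₁') aF) (min (m * a₅ / (O₁ * C₁ * B₃)) (a₀ / B₃)) with hb₁def
  have hb₁pos : 0 < b₁ := by
    simp only [hb₁def, lt_min_iff]
    exact ⟨⟨mul_pos hm ha₁', haF⟩, div_pos (mul_pos hm ha₅) hK, div_pos ha₀ hB₃⟩
  have h1 : b₁ ≤ m * a₁' := le_trans (min_le_left _ _) (min_le_left _ _)
  have h2 : b₁ ≤ aF := le_trans (min_le_left _ _) (min_le_right _ _)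
  have h3 : b₁ ≤ m * a₅ / (O₁ * C₁ * B₃) := le_trans (min_le_right _ _) (min_le_left _ _)
  have h4 : b₁ ≤ a₀ / B₃ := le_trans (min_le_right _ _) (min_le_right _ _)
  set a₁ : ℝ := b₁ / T.κ₀ with ha₁def
  have ha₁pos : 0 < a₁ := div_pos hb₁pos hκ₀pos
  have hB₃a₁ : B₃ * T.κ₀ * a₁ ≤ a₀ := by
    have e1 : B₃ * T.κ₀ * a₁ = B₃ * b₁ := by rw [ha₁def]; field_simp
    have e2 : B₃ * b₁ ≤ a₀ := by
      have := (le_div_iff₀ hB₃).1 h4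
      linarith [mul_comm B₃ b₁]
    linarith
  have hMpos : ∀ e : ℝ, 0 < e → 0 < RM * (a₁ / e) := fun e he => by positivity
  -- the level-free step (Sects. B–F from a background (14)), one-sided dictionary, to be used at the parameter `κ₀ε₁`
  have step := thm1_clauses_of_background_oneSided T.toTower mono minlaw restr uniq mono7 hNear B₃ C₁ a₀ a₁' O₁ a₅ aF B₄ RM b₁
    hB₃ hC₁pos hK hRM hm hm1 hmO h1 h2 h3 H7 H8 HF
  refine ⟨⟨a₀, a₁, B₃ * T.κ₀, B₄ * T.κ₀, fun e => RM * (a₁ / e), ha₀, ha₁pos, by positivity, by positivity, hB₃a₁, hMpos⟩, rfl, ?_⟩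
  -- conversion of the step's output at `(B₃, κ₀ε₁)` into Theorem 1″'s clauses at `(B₃κ₀, ε₁)`
  have conv : ∀ (n : ℕ) (i : T.I n) (ε₁ : ℝ), 0 < ε₁ → ε₁ ≤ a₁ → ∀ (V : (T.fam n i).Bdry)
      (U₀ : (T.fam n i).Cfg), T.RegT n i ε₁ V → (T.fam n i).Sat14 C₁ B₃ (T.κ₀ * ε₁) V U₀ →
      Exists8 (T.fam n i).toVarProblem (B₃ * T.κ₀) ε₁ V ∧
        Unique6 (T.fam n i).toVarProblem a₀ (B₃ * T.κ₀) ε₁ V ∧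
        Reg910 (T.fam n i).toVarProblem (B₃ * T.κ₀) (B₄ * T.κ₀) ε₁ (RM * (a₁ / ε₁)) V := by
    intro n i ε₁ hε hεa V U₀ hV h14
    have hε' : 0 < T.κ₀ * ε₁ := mul_pos hκ₀pos hε
    have hεb : T.κ₀ * ε₁ ≤ b₁ := by
      have := (le_div_iff₀ hκ₀pos).1 hεa
      linarith [mul_comm T.κ₀ ε₁]
    have hV7 : (T.fam n i).Reg7 (T.κ₀ * ε₁) V := hRegT7 n i ε₁ V hV
    obtain ⟨hE, hU, hR⟩ := step n i (T.κ₀ * ε₁) hε' hεb V hV7 U₀ h14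
    have hM : RM * (b₁ / (T.κ₀ * ε₁)) = RM * (a₁ / ε₁) := by
      rw [ha₁def, div_div]
    refine ⟨(exists8_reparam _ _ _ _ _).1 hE, (unique6_reparam _ _ _ _ _ _).1 hU, ?_⟩
    rw [← hM]
    exact (reg910_reparam _ _ _ _ _ _ _).1 hR
  intro n
  induction n with
  | zero =>
      intro i ε₁ hε hεa V hV
      exact conv 0 i ε₁ hε hεa V (T.base i V) hV (hK1 i ε₁ V hε hV)
  | succ n ih =>
      intro i ε₁ hε hεa V hV
      have hV₀ : T.RegT n (T.drop n i) ε₁ (T.V0c n i V) := hA11 n i ε₁ V hV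
      obtain ⟨U', hU'in, hU'B, -⟩ := (ih (T.drop n i) ε₁ hε hεa (T.V0c n i V) hV₀).1
      obtain ⟨h13U, h13N⟩ := hA13 n i ε₁ (B₃ * T.κ₀ * ε₁) V U' hV hU'in hU'B
      have h14 : (T.fam (n + 1) i).Sat14 C₁ B₃ (T.κ₀ * ε₁) V (T.lift n i U') := by
        refine ⟨mono (n + 1) i _ _ _ ?_ h13U, hNear (n + 1) i _ _ V _ ?_ h13N⟩
        · have : 0 ≤ B₃ * T.κ₀ * ε₁ := by positivity
          nlinarith
        · have : C₁ * ε₁ ≤ C₁ * (T.κ₀ * ε₁) := by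
            apply mul_le_mul_of_nonneg_left _ hC₁pos.le
            nlinarith
          nlinarith
      exact conv (n + 1) i ε₁ hε hεa V (T.lift n i U') hV h14
include mono in
/-- **The background supply of Sect. A in the repaired form, ONE-SIDED DICTIONARY** — `B11Thm1TwoTier.background_of_thm1TAt` (it needs the dictionary only through
the monotonicity (i) of (2)). [cite: Balaban1985Variational, (11)–(14) pp.279–280] -/
theorem background_of_thm1TAt_oneSided (C : B11Thm1.Consts) (C₁ : ℝ)
    (cl : T.ClassLaws) (hC₁L : T.L ^ 3 ≤ C₁) (hC₁' : T.C₁' ≤ C₁) (hL : 1 ≤ T.L) (hCB : 0 < C.B₃)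
    (hA11 : StepA11T T) (hA13 : StepA13T T) (hK1 : BaseK1T T (C.B₃ / T.κ₀) C₁)
    (H : ∀ (n : ℕ) (i : T.I n), Thm1TAt T C n i)
    (n : ℕ) (i : T.I n) (ε₁ : ℝ) (hε₁ : 0 < ε₁) (hε₁a : ε₁ ≤ C.a₁) (V : (T.fam n i).Bdry)
    (hV : T.RegT n i ε₁ V) :
    ∃ U₀ : (T.fam n i).Cfg, (T.fam n i).Sat14 C₁ (C.B₃ / T.κ₀) (T.κ₀ * ε₁) V U₀ := by
  obtain ⟨hκ₀, hC₁'0, -, -, hNear⟩ := cl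
  have hκ₀pos : 0 < T.κ₀ := lt_of_lt_of_le one_pos hκ₀
  have hL3 : 1 ≤ T.L ^ 3 := one_le_pow₀ hL
  have hC₁pos : 0 < C₁ := lt_of_lt_of_le (lt_of_lt_of_le one_pos hL3) hC₁L
  cases n with
  | zero => exact ⟨T.base i V, hK1 i ε₁ V hε₁ hV⟩
  | succ n =>
      have hV₀ : T.RegT n (T.drop n i) ε₁ (T.V0c n i V) := hA11 n i ε₁ V hV
      obtain ⟨U', hU'in, hU'B, -⟩ := (H n (T.drop n i) ε₁ hε₁ hε₁a (T.V0c n i V) hV₀).1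
      obtain ⟨h13U, h13N⟩ := hA13 n i ε₁ (C.B₃ * ε₁) V U' hV hU'in hU'B
      refine ⟨T.lift n i U', mono (n + 1) i _ _ _ ?_ h13U, hNear (n + 1) i _ _ V _ ?_ h13N⟩
      · have e : C₁ * (C.B₃ / T.κ₀) * (T.κ₀ * ε₁) = C₁ * (C.B₃ * ε₁) := by field_simp
        rw [e]
        have : 0 ≤ C.B₃ * ε₁ := by positivity
        nlinarith
      · have : C₁ * ε₁ ≤ C₁ * (T.κ₀ * ε₁) := by
          apply mul_le_mul_of_nonneg_left _ hC₁pos.le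
          nlinarith
        nlinarith

/-! ## §4 The knit from Props 2, 5, 6 over the repaired tower, under the one-sided dictionary -/

variable (famD : (Σ n, T.I n) → LGData) (β : ∀ p : Σ n, T.I n, Bridge (T.famAllX p) (famD p))
  (bg : ∀ p : Σ n, T.I n, (T.fam p.1 p.2).Cfg → (famD p).Cfg)
include mono minlaw restr uniq mono7 in
/-- **Theorem 1″ at every level from Props 2, 5, 6, Prop 8, Sect. F and the located leaves, ONE-SIDED DICTIONARY** — `B11LeafKnitTwoTier.thm1TAt_towerT_of_parts` with
`lawsA` replaced by (i), (ii), (iii′), (iv) + (7) monotone (its `Prop7From14` input is `prop7From14_towerT`, dictionary-free). [cite: Balaban1985Variational, Thm 1 p.279; Prop. 7 p.299; (14) p.280; (122) p.296] -/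
theorem thm1TAt_towerT_of_parts_oneSided {B₀ B₁ B₃ C₁ c₁ O₁ O₂ e₅ : ℝ}
    (hbg14 : ∀ (p : Σ n, T.I n) (ε : ℝ) (V : (T.fam p.1 p.2).Bdry) (U : (T.fam p.1 p.2).Cfg),
      (T.fam p.1 p.2).Sat14 C₁ B₃ ε V U → (famD p).Sat14 (C₁ * B₃ * ε) (C₁ * ε) ((β p).bdry V) (bg p U))
    (laws : ∀ p, (β p).Laws C₁ B₃) (leaves : ∀ p, ExistenceLeavesCap (β p) B₀ B₃ C₁ O₁ O₂ e₅)
    (cl : T.ClassLaws) (hA11 : StepA11T T) (hA13 : StepA13T T) (hK1 : BaseK1T T B₃ C₁)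
    (hB₀ : 0 < B₀) (hB₁ : 0 < B₁) (hB₃ : 1 ≤ B₃) (hL : 1 ≤ T.L) (hC₁L : T.L ^ 3 ≤ C₁) (hC₁' : T.C₁' ≤ C₁)
    (hB₀B₁ : B₀ ≤ 4 * B₁) (hc₁ : 0 < c₁) (hO₁ : 0 < O₁) (hO₂ : 0 < O₂) (he₅ : 0 < e₅)
    (p2 : Prop2Printed B₁ B₃ C₁ c₁ famD) (p5 : Prop5Printed B₁ B₃ C₁ famD) (p6 : Prop6Printed B₀ B₃ C₁ famD)
    (p8 : Prop8Printed B₃ T.famAllX) (sF : SectFPrinted B₃ T.famAllX) :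
    ∃ C : B11Thm1.Consts, C.B₃ = B₃ * T.κ₀ ∧ ∀ (n : ℕ) (i : T.I n), Thm1TAt T C n i :=
  thm1TAt_allLevels_oneSided T mono minlaw restr uniq mono7 B₃ C₁ (lt_of_lt_of_le one_pos hB₃) hL hC₁L hC₁' cl hA11 hA13 hK1
    (B11LeafKnitTwoTier.prop7From14_towerT T famD β bg hbg14 laws leaves hB₀ hB₁ hB₃ ((one_le_pow₀ hL).trans hC₁L) hB₀B₁ hc₁ hO₁ hO₂ he₅
      p2 p5 p6) p8 sF

include mono minlaw restr uniq mono7 in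
/-- **The printed background-free Proposition 7 over all levels AT `(B₃κ₀, C₁)`, ONE-SIDED DICTIONARY** — `B11LeafKnitTwoTier.prop7Printed_towerT_of_parts` with `lawsA`
replaced as above: backgrounds from the one-sided repaired induction at the parameter `κ₀ε₁` for `ε₁ ≤ a₁″` (`background_of_thm1TAt_oneSided`), then pv12's `Prop7From14`
read at that parameter; `a₀ ↦ min{a₀, B₃κ₀a₁″}`, `a′₁ ↦ min{a′₁∕κ₀, a₁″}`. [cite: Balaban1985Variational, Prop. 7 p.299; (11)–(14) pp.279–280] -/
theorem prop7Printed_towerT_of_parts_oneSided {B₀ B₁ B₃ C₁ c₁ O₁ O₂ e₅ : ℝ}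
    (hbg14 : ∀ (p : Σ n, T.I n) (ε : ℝ) (V : (T.fam p.1 p.2).Bdry) (U : (T.fam p.1 p.2).Cfg),
      (T.fam p.1 p.2).Sat14 C₁ B₃ ε V U → (famD p).Sat14 (C₁ * B₃ * ε) (C₁ * ε) ((β p).bdry V) (bg p U))
    (laws : ∀ p, (β p).Laws C₁ B₃) (leaves : ∀ p, ExistenceLeavesCap (β p) B₀ B₃ C₁ O₁ O₂ e₅)
    (cl : T.ClassLaws) (hA11 : StepA11T T) (hA13 : StepA13T T) (hK1 : BaseK1T T B₃ C₁)
    (hB₀ : 0 < B₀) (hB₁ : 0 < B₁) (hB₃ : 1 ≤ B₃) (hL : 1 ≤ T.L) (hC₁L : T.L ^ 3 ≤ C₁) (hC₁' : T.C₁' ≤ C₁)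
    (hB₀B₁ : B₀ ≤ 4 * B₁) (hc₁ : 0 < c₁) (hO₁ : 0 < O₁) (hO₂ : 0 < O₂) (he₅ : 0 < e₅)
    (p2 : Prop2Printed B₁ B₃ C₁ c₁ famD) (p5 : Prop5Printed B₁ B₃ C₁ famD) (p6 : Prop6Printed B₀ B₃ C₁ famD)
    (p8 : Prop8Printed B₃ T.famAllX) (sF : SectFPrinted B₃ T.famAllX) :
    Prop7Printed (B₃ * T.κ₀) C₁ T.famAllX := by
  have hB₃pos : 0 < B₃ := lt_of_lt_of_le one_pos hB₃
  have hC₁ : 1 ≤ C₁ := (one_le_pow₀ hL).trans hC₁L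
  have h7 : Prop7From14 T.toTower B₃ C₁ :=
    B11LeafKnitTwoTier.prop7From14_towerT T famD β bg hbg14 laws leaves hB₀ hB₁ hB₃ hC₁ hB₀B₁ hc₁ hO₁ hO₂ he₅ p2 p5 p6
  obtain ⟨C, hCB, HT⟩ := thm1TAt_allLevels_oneSided T mono minlaw restr uniq mono7 B₃ C₁ hB₃pos hL hC₁L hC₁' cl hA11 hA13 hK1 h7 p8 sF
  obtain ⟨a₀, a₁', O, ha₀, ha₁', hO, H⟩ := h7
  have hκ₀ : 1 ≤ T.κ₀ := cl.1
  have hReg7T := cl.2.2.1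
  have hRegT7 := cl.2.2.2.1
  have hκ₀pos : 0 < T.κ₀ := lt_of_lt_of_le one_pos hκ₀
  have hCBpos : 0 < C.B₃ := by rw [hCB]; positivity
  have hdiv : C.B₃ / T.κ₀ = B₃ := by rw [hCB]; field_simp
  have hK1' : BaseK1T T (C.B₃ / T.κ₀) C₁ := by rw [hdiv]; exact hK1
  have Hbg : ∀ (n : ℕ) (i : T.I n) (ε₁ : ℝ), 0 < ε₁ → ε₁ ≤ C.a₁ → ∀ V : (T.fam n i).Bdry, (T.fam n i).Reg7 ε₁ V →
      ∃ U₀ : (T.fam n i).Cfg, (T.fam n i).Sat14 C₁ B₃ (T.κ₀ * ε₁) V U₀ := by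
    intro n i ε₁ hε₁ hε₁a V hV
    have h := background_of_thm1TAt_oneSided T mono C C₁ cl hC₁L hC₁' hL hCBpos hA11 hA13 hK1' HT n i ε₁ hε₁ hε₁a V
      (hReg7T n i ε₁ V hV)
    rwa [hdiv] at h
  have hBκ : 0 < B₃ * T.κ₀ := mul_pos hB₃pos hκ₀pos
  refine ⟨min a₀ (B₃ * T.κ₀ * C.a₁), min (a₁' / T.κ₀) C.a₁, O, lt_min ha₀ (mul_pos hBκ C.a₁_pos),
    lt_min (div_pos ha₁' hκ₀pos) C.a₁_pos, hO, fun p ε₀ ε₁ hε₁ V hV => ⟨?_, ?_⟩⟩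
  · intro hε₀ hB₃ε
    have hε₁a : ε₁ ≤ C.a₁ := by
      have h : B₃ * T.κ₀ * ε₁ ≤ B₃ * T.κ₀ * C.a₁ := hB₃ε.trans (hε₀.trans (min_le_right _ _))
      exact le_of_mul_le_mul_left h hBκ
    obtain ⟨U₀, h14⟩ := Hbg p.1 p.2 ε₁ hε₁ hε₁a V hV
    have hκε : 0 < T.κ₀ * ε₁ := mul_pos hκ₀pos hε₁
    exact (H p.1 p.2 ε₀ (T.κ₀ * ε₁) hκε V (hRegT7 p.1 p.2 ε₁ V (hReg7T p.1 p.2 ε₁ V hV)) U₀ h14).1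
      (hε₀.trans (min_le_left _ _)) (by nlinarith)
  · intro hε₁a
    have hε₁C : ε₁ ≤ C.a₁ := hε₁a.trans (min_le_right _ _)
    have hε₁κ : T.κ₀ * ε₁ ≤ a₁' := by
      have := (le_div_iff₀ hκ₀pos).1 (hε₁a.trans (min_le_left _ _))
      linarith [mul_comm T.κ₀ ε₁]
    obtain ⟨U₀, h14⟩ := Hbg p.1 p.2 ε₁ hε₁ hε₁C V hV
    have hκε : 0 < T.κ₀ * ε₁ := mul_pos hκ₀pos hε₁
    obtain ⟨U, hU⟩ := (H p.1 p.2 ε₀ (T.κ₀ * ε₁) hκε V (hRegT7 p.1 p.2 ε₁ V (hReg7T p.1 p.2 ε₁ V hV)) U₀ h14).2 hε₁κ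
    refine ⟨U, ?_⟩
    have e : O * C₁ * (B₃ * T.κ₀) * ε₁ = O * C₁ * B₃ * (T.κ₀ * ε₁) := by ring
    rw [e]
    exact hU

end TwoTier

end Literature.MathematicalPhysics.QuantumFieldTheory.Balaban1983to89.B11Thm1TwoTierOneSided
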